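import Mathlib
import HarnessLib
import Summits.HubbardSuperconductivity.HubbardSuperconductivity.Theorems.KLProgrammeKLRegimeFatAngularFactor
import Summits.HubbardSuperconductivity.HubbardSuperconductivity.Theorems.KLProgrammeKLRegimeSymbolAngularFactorSingle
import Summits.HubbardSuperconductivity.HubbardSuperconductivity.Theorems.KLProgrammeKLRegimeSymbolLineDerivThree

/-!
# Route `KLProgramme` — engine support, route (L2) symbol layer for the FAT sector family: line derivatives of the fat angular factor
# `Z_fat = Σ_{a∈S₁}Σ_{b∈S₂} Z_{ab}` up to ORDER THREE

Cell `gate-hubbard-kl`, seat p3 (g10); the order-three extension of k3c2-p3's `…FatAngularFactor.abs_derivs_fatAngular_line_le` (orders `≤ 2`),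
for the α_w(n) weighted rows of stmt-HubbardSuperconductivity-20437 (`stub_engine_step_norms`, located risk «(b)-Wt@j≥1»): the mixed master lemma
`sum_wt_norm_charSum_le_of_mixed_differences` asks for THIRD differences of the fat pair multiplier, whose angular factor is `Z_fat`.
With `B` the constant of `exists_norm_iteratedDeriv_sectorWeightCirc_polarAngle_line_le 3` and `D = (1 + 6/w_n)‖w₁ + iw₂‖`:

* `abs_derivs3_angularFactor_line_le` — the TWO-sector factor `Z_{ab} = χ_sq χ_sq·(Rζ̃_{n,a})(Rζ̃_{n,b})` (equal angular scales) at a point of the open square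
  with `‖·‖ ≥ 1`: `|∂ₛZ_{ab}| ≤ 12B·D`, `|∂ₛ²Z_{ab}| ≤ (12B + 72B²)·D²`, `|∂ₛ³Z_{ab}| ≤ (12B + 216B²)·D³` (Leibniz at orders 1, 2, 3 on the two
  plateaued factors, each with `|∂ⁱ| ≤ 6B·Dⁱ` from `abs_iteratedDeriv_plateaued_line_le₃` and `|·| ≤ 1`);
* **`abs_derivs3_fatAngular_line_le`** — `|∂ₛʲ Z_fat| ≤ |S₁||S₂|·c_j(B)·Dʲ`, `j = 1, 2, 3`.

Everything is proved; no definitions, no named facts. [folklore] (BGM 2006 §2.5 Lemma 2.2, §2.7 (2.66), (2.71a).)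
-/

noncomputable section

namespace Summit.HubbardSuperconductivity.HubbardSuperconductivity.Theorems.TorusFourierL2

set_option linter.dupNamespace false -- summit = problem name (single-conjunct summit), D-0017

open Set Finset Filter Topology Complex Literature.MathematicalPhysics.QuantumLattice Literature.Analysis.SpecialFunctions
open scoped Real Nat

/-! ### §1 The two-sector angular factor at order three -/

/-- **Line derivatives of the two-sector angular factor up to order three** (equal angular scales `n`) at a point `p₀ + s•w` of the open square with
`‖·‖ ≥ 1`: `|∂ₛZ| ≤ 12B·D`, `|∂ₛ²Z| ≤ (12B + 72B²)·D²`, `|∂ₛ³Z| ≤ (12B + 216B²)·D³`, `D = (1 + 6/w_n)‖w₁+iw₂‖`.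
[cite: BenfattoGiulianiMastropietro2006, §2.5 Lemma 2.2] -/
theorem abs_derivs3_angularFactor_line_le {z : ℝ} (hz : 0 < z) {n : ℕ} {ω₁ ω₂ : ℤ} {Z : (Fin 2 → ℝ) → ℝ}
    (hZ : ∀ p, Z p = gnCutoff ((π + z) ^ 2 / π ^ 2) ((π + z) ^ 2) (p 0 ^ 2) * gnCutoff ((π + z) ^ 2 / π ^ 2) ((π + z) ^ 2) (p 1 ^ 2) *
      ((radialCutoffC (1 / 2) (momToComplex p) * sectorWeightCirc n ω₁ (polarAngle p)) *
        (radialCutoffC (1 / 2) (momToComplex p) * sectorWeightCirc n ω₂ (polarAngle p))))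
    {B : ℝ} (hB0 : 0 ≤ B)
    (hB : ∀ (i : ℕ), i ≤ 3 → ∀ (n : ℕ) (ω : ℤ) (θ₀ : ℝ) (q w : Fin 2 → ℝ) (t : ℝ) {r₀ : ℝ}, 0 < r₀ →
      r₀ ≤ ‖momToComplex (q + t • w)‖ → |sectorRelAngle θ₀ (q + t • w)| < π →
      ‖iteratedDeriv i (fun t : ℝ => sectorWeightCirc n ω (polarAngle (q + t • w))) t‖ ≤
        (3 : ℕ)! * B * ((1 + (sectorWidth n)⁻¹ * (3 : ℕ)!) * ‖momToComplex w‖ / r₀) ^ i)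
    (p₀ w : Fin 2 → ℝ) {s : ℝ} (hsq : ∀ i, |(p₀ + s • w) i| < π) (hfermi : 1 ≤ ‖momToComplex (p₀ + s • w)‖) :
    |deriv (fun σ : ℝ => Z (p₀ + σ • w)) s| ≤ 12 * B * ((1 + 6 * (sectorWidth n)⁻¹) * ‖momToComplex w‖) ∧
      |iteratedDeriv 2 (fun σ : ℝ => Z (p₀ + σ • w)) s| ≤ (12 * B + 72 * B ^ 2) * ((1 + 6 * (sectorWidth n)⁻¹) * ‖momToComplex w‖) ^ 2 ∧
      |iteratedDeriv 3 (fun σ : ℝ => Z (p₀ + σ • w)) s| ≤ (12 * B + 216 * B ^ 2) * ((1 + 6 * (sectorWidth n)⁻¹) * ‖momToComplex w‖) ^ 3 := by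
  set g₁ : ℝ → ℝ := fun σ => radialCutoffC (1 / 2) (momToComplex (p₀ + σ • w)) * sectorWeightCirc n ω₁ (polarAngle (p₀ + σ • w))
    with hg₁
  set g₂ : ℝ → ℝ := fun σ => radialCutoffC (1 / 2) (momToComplex (p₀ + σ • w)) * sectorWeightCirc n ω₂ (polarAngle (p₀ + σ • w))
    with hg₂
  set D : ℝ := (1 + 6 * (sectorWidth n)⁻¹) * ‖momToComplex w‖ with hD
  have hev := angularFactor_line_eventuallyEq hZ hz p₀ w hsq
  have hc₁ : ContDiff ℝ 3 g₁ := contDiff_plateaued_line n ω₁ p₀ w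
  have hc₂ : ContDiff ℝ 3 g₂ := contDiff_plateaued_line n ω₂ p₀ w
  have hc₁' : ContDiff ℝ 2 g₁ := contDiff_plateaued_line n ω₁ p₀ w
  have hc₂' : ContDiff ℝ 2 g₂ := contDiff_plateaued_line n ω₂ p₀ w
  -- sizes of the factors and their derivatives at `s`
  have hb : ∀ (ω : ℤ) (σ : ℝ), |radialCutoffC (1 / 2) (momToComplex (p₀ + σ • w)) * sectorWeightCirc n ω (polarAngle (p₀ + σ • w))| ≤ 1 := by
    intro ω σ
    rw [abs_mul, abs_of_nonneg (radialCutoffC_mem_Icc _ _).1, abs_of_nonneg (sectorWeightCirc_nonneg _ _ _)]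
    exact mul_le_one₀ (radialCutoffC_mem_Icc _ _).2 (sectorWeightCirc_nonneg _ _ _) (sectorWeightCirc_le_one _ _ _)
  have h10 : |g₁ s| ≤ 1 := hb ω₁ s
  have h20 : |g₂ s| ≤ 1 := hb ω₂ s
  have h11 : |deriv g₁ s| ≤ 6 * B * D := by
    have h := abs_iteratedDeriv_plateaued_line_le₃ hB n ω₁ p₀ w hfermi (i := 1) (by norm_num)
    rw [iteratedDeriv_one, pow_one] at h; exact h
  have h21 : |deriv g₂ s| ≤ 6 * B * D := by
    have h := abs_iteratedDeriv_plateaued_line_le₃ hB n ω₂ p₀ w hfermi (i := 1) (by norm_num)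
    rw [iteratedDeriv_one, pow_one] at h; exact h
  have h12 : |iteratedDeriv 2 g₁ s| ≤ 6 * B * D ^ 2 := abs_iteratedDeriv_plateaued_line_le₃ hB n ω₁ p₀ w hfermi (i := 2) (by norm_num)
  have h22 : |iteratedDeriv 2 g₂ s| ≤ 6 * B * D ^ 2 := abs_iteratedDeriv_plateaued_line_le₃ hB n ω₂ p₀ w hfermi (i := 2) (by norm_num)
  have h13 : |iteratedDeriv 3 g₁ s| ≤ 6 * B * D ^ 3 := abs_iteratedDeriv_plateaued_line_le₃ hB n ω₁ p₀ w hfermi (i := 3) le_rfl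
  have h23 : |iteratedDeriv 3 g₂ s| ≤ 6 * B * D ^ 3 := abs_iteratedDeriv_plateaued_line_le₃ hB n ω₂ p₀ w hfermi (i := 3) le_rfl
  have hD0 : 0 ≤ D := by have := sectorWidth_pos n; positivity
  refine ⟨?_, ?_, ?_⟩
  · rw [hev.deriv_eq, deriv_mul₂ hc₁' hc₂' s]
    calc _ ≤ |deriv g₁ s * g₂ s| + |g₁ s * deriv g₂ s| := abs_add_le _ _
      _ = |deriv g₁ s| * |g₂ s| + |g₁ s| * |deriv g₂ s| := by
          rw [abs_mul (deriv g₁ s) (g₂ s), abs_mul (g₁ s) (deriv g₂ s)]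
      _ ≤ 6 * B * D * 1 + 1 * (6 * B * D) :=
          add_le_add (mul_le_mul h11 h20 (abs_nonneg _) (by positivity)) (mul_le_mul h10 h21 (abs_nonneg _) zero_le_one)
      _ = 12 * B * D := by ring
  · rw [hev.iteratedDeriv_eq, iteratedDeriv_two_mul₂ hc₁' hc₂' s]
    calc _ ≤ |iteratedDeriv 2 g₁ s * g₂ s + 2 * (deriv g₁ s * deriv g₂ s)| + |g₁ s * iteratedDeriv 2 g₂ s| := abs_add_le _ _
      _ ≤ |iteratedDeriv 2 g₁ s * g₂ s| + |2 * (deriv g₁ s * deriv g₂ s)| + |g₁ s * iteratedDeriv 2 g₂ s| := by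
          gcongr; exact abs_add_le _ _
      _ = |iteratedDeriv 2 g₁ s| * |g₂ s| + 2 * (|deriv g₁ s| * |deriv g₂ s|) + |g₁ s| * |iteratedDeriv 2 g₂ s| := by
          rw [abs_mul (iteratedDeriv 2 g₁ s) (g₂ s), abs_mul (2 : ℝ) _, abs_mul (deriv g₁ s) (deriv g₂ s),
            abs_mul (g₁ s) (iteratedDeriv 2 g₂ s), abs_two]
      _ ≤ 6 * B * D ^ 2 * 1 + 2 * ((6 * B * D) * (6 * B * D)) + 1 * (6 * B * D ^ 2) := by
          refine add_le_add (add_le_add ?_ ?_) ?_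
          · exact mul_le_mul h12 h20 (abs_nonneg _) (by positivity)
          · exact mul_le_mul_of_nonneg_left (mul_le_mul h11 h21 (abs_nonneg _) (by positivity)) (by norm_num)
          · exact mul_le_mul h10 h22 (abs_nonneg _) zero_le_one
      _ = (12 * B + 72 * B ^ 2) * D ^ 2 := by ring
  · rw [hev.iteratedDeriv_eq, iteratedDeriv_three_mul₃ hc₁ hc₂ s]
    calc _ ≤ |iteratedDeriv 3 g₁ s * g₂ s + 3 * (iteratedDeriv 2 g₁ s * deriv g₂ s) + 3 * (deriv g₁ s * iteratedDeriv 2 g₂ s)| +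
          |g₁ s * iteratedDeriv 3 g₂ s| := abs_add_le _ _
      _ ≤ |iteratedDeriv 3 g₁ s * g₂ s + 3 * (iteratedDeriv 2 g₁ s * deriv g₂ s)| + |3 * (deriv g₁ s * iteratedDeriv 2 g₂ s)| +
          |g₁ s * iteratedDeriv 3 g₂ s| := by
          gcongr; exact abs_add_le _ _
      _ ≤ |iteratedDeriv 3 g₁ s * g₂ s| + |3 * (iteratedDeriv 2 g₁ s * deriv g₂ s)| + |3 * (deriv g₁ s * iteratedDeriv 2 g₂ s)| +
          |g₁ s * iteratedDeriv 3 g₂ s| := by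
          gcongr; exact abs_add_le _ _
      _ = |iteratedDeriv 3 g₁ s| * |g₂ s| + 3 * (|iteratedDeriv 2 g₁ s| * |deriv g₂ s|) + 3 * (|deriv g₁ s| * |iteratedDeriv 2 g₂ s|) +
          |g₁ s| * |iteratedDeriv 3 g₂ s| := by
          rw [abs_mul (iteratedDeriv 3 g₁ s) (g₂ s), abs_mul (3 : ℝ) _, abs_mul (3 : ℝ) _, abs_mul (iteratedDeriv 2 g₁ s) (deriv g₂ s),
            abs_mul (deriv g₁ s) (iteratedDeriv 2 g₂ s), abs_mul (g₁ s) (iteratedDeriv 3 g₂ s), abs_of_pos (by norm_num : (0 : ℝ) < 3)]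
      _ ≤ 6 * B * D ^ 3 * 1 + 3 * ((6 * B * D ^ 2) * (6 * B * D)) + 3 * ((6 * B * D) * (6 * B * D ^ 2)) + 1 * (6 * B * D ^ 3) := by
          refine add_le_add (add_le_add (add_le_add ?_ ?_) ?_) ?_
          · exact mul_le_mul h13 h20 (abs_nonneg _) (by positivity)
          · exact mul_le_mul_of_nonneg_left (mul_le_mul h12 h21 (abs_nonneg _) (by positivity)) (by norm_num)
          · exact mul_le_mul_of_nonneg_left (mul_le_mul h11 h22 (abs_nonneg _) (by positivity)) (by norm_num)
          · exact mul_le_mul h10 h23 (abs_nonneg _) zero_le_one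
      _ = (12 * B + 216 * B ^ 2) * D ^ 3 := by ring

/-! ### §2 The fat angular factor at order three -/

section Fat

variable {z : ℝ} {n : ℕ} {S₁ S₂ : Finset ℕ} {Z : (Fin 2 → ℝ) → ℝ}
  (hZ : ∀ p, Z p = gnCutoff ((π + z) ^ 2 / π ^ 2) ((π + z) ^ 2) (p 0 ^ 2) * gnCutoff ((π + z) ^ 2 / π ^ 2) ((π + z) ^ 2) (p 1 ^ 2) *
    ((radialCutoffC (1 / 2) (momToComplex p) * ∑ a ∈ S₁, sectorWeightCirc n ((a : ℕ) : ℤ) (polarAngle p)) *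
      (radialCutoffC (1 / 2) (momToComplex p) * ∑ b ∈ S₂, sectorWeightCirc n ((b : ℕ) : ℤ) (polarAngle p))))
include hZ

/-- **Line derivatives of the fat angular factor up to order three** at a point `p₀ + s•w` of the open square with `‖·‖ ≥ 1`:
`|∂ₛZ| ≤ |S₁||S₂|·12B·D`, `|∂ₛ²Z| ≤ |S₁||S₂|·(12B + 72B²)·D²`, `|∂ₛ³Z| ≤ |S₁||S₂|·(12B + 216B²)·D³`, `D = (1 + 6/w_n)‖w₁ + iw₂‖`,
`B` the constant of `exists_norm_iteratedDeriv_sectorWeightCirc_polarAngle_line_le 3`. [cite: BenfattoGiulianiMastropietro2006, §2.5 Lemma 2.2, §2.7 (2.71a)] -/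
theorem abs_derivs3_fatAngular_line_le (hz : 0 < z) {B : ℝ} (hB0 : 0 ≤ B)
    (hB : ∀ (i : ℕ), i ≤ 3 → ∀ (n : ℕ) (ω : ℤ) (θ₀ : ℝ) (q w : Fin 2 → ℝ) (t : ℝ) {r₀ : ℝ}, 0 < r₀ →
      r₀ ≤ ‖momToComplex (q + t • w)‖ → |sectorRelAngle θ₀ (q + t • w)| < π →
      ‖iteratedDeriv i (fun t : ℝ => sectorWeightCirc n ω (polarAngle (q + t • w))) t‖ ≤
        (3 : ℕ)! * B * ((1 + (sectorWidth n)⁻¹ * (3 : ℕ)!) * ‖momToComplex w‖ / r₀) ^ i)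
    (p₀ w : Fin 2 → ℝ) {s : ℝ} (hsq : ∀ i, |(p₀ + s • w) i| < π) (hfermi : 1 ≤ ‖momToComplex (p₀ + s • w)‖) :
    |deriv (fun σ : ℝ => Z (p₀ + σ • w)) s| ≤
        (S₁.card * S₂.card : ℝ) * (12 * B * ((1 + 6 * (sectorWidth n)⁻¹) * ‖momToComplex w‖)) ∧
      |iteratedDeriv 2 (fun σ : ℝ => Z (p₀ + σ • w)) s| ≤
        (S₁.card * S₂.card : ℝ) * ((12 * B + 72 * B ^ 2) * ((1 + 6 * (sectorWidth n)⁻¹) * ‖momToComplex w‖) ^ 2) ∧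
      |iteratedDeriv 3 (fun σ : ℝ => Z (p₀ + σ • w)) s| ≤
        (S₁.card * S₂.card : ℝ) * ((12 * B + 216 * B ^ 2) * ((1 + 6 * (sectorWidth n)⁻¹) * ‖momToComplex w‖) ^ 3) := by
  set D : ℝ := (1 + 6 * (sectorWidth n)⁻¹) * ‖momToComplex w‖ with hD
  -- the summands along the line
  set g : ℕ → ℕ → ℝ → ℝ := fun a b σ =>
    gnCutoff ((π + z) ^ 2 / π ^ 2) ((π + z) ^ 2) ((p₀ + σ • w) 0 ^ 2) * gnCutoff ((π + z) ^ 2 / π ^ 2) ((π + z) ^ 2) ((p₀ + σ • w) 1 ^ 2) *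
      ((radialCutoffC (1 / 2) (momToComplex (p₀ + σ • w)) * sectorWeightCirc n ((a : ℕ) : ℤ) (polarAngle (p₀ + σ • w))) *
        (radialCutoffC (1 / 2) (momToComplex (p₀ + σ • w)) * sectorWeightCirc n ((b : ℕ) : ℤ) (polarAngle (p₀ + σ • w))))
    with hg
  have hline : (fun σ : ℝ => Z (p₀ + σ • w)) = fun σ => ∑ a ∈ S₁, ∑ b ∈ S₂, g a b σ := by
    funext σ; rw [fatAngular_eq_sum hZ]
  have hsm : ∀ a b, ContDiff ℝ 3 (g a b) := by
    intro a b
    have hc := contDiff_angularFactor (n₁ := n) (n₂ := n) (ω₁ := ((a : ℕ) : ℤ)) (ω₂ := ((b : ℕ) : ℤ)) (z := z) (m := 3)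
      (Z := fun p => gnCutoff ((π + z) ^ 2 / π ^ 2) ((π + z) ^ 2) (p 0 ^ 2) * gnCutoff ((π + z) ^ 2 / π ^ 2) ((π + z) ^ 2) (p 1 ^ 2) *
        ((radialCutoffC (1 / 2) (momToComplex p) * sectorWeightCirc n ((a : ℕ) : ℤ) (polarAngle p)) *
          (radialCutoffC (1 / 2) (momToComplex p) * sectorWeightCirc n ((b : ℕ) : ℤ) (polarAngle p)))) (fun _ => rfl)
    exact hc.comp (contDiff_const.add (contDiff_id.smul contDiff_const))
  have hbd : ∀ a b, |deriv (g a b) s| ≤ 12 * B * D ∧ |iteratedDeriv 2 (g a b) s| ≤ (12 * B + 72 * B ^ 2) * D ^ 2 ∧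
      |iteratedDeriv 3 (g a b) s| ≤ (12 * B + 216 * B ^ 2) * D ^ 3 := by
    intro a b
    exact abs_derivs3_angularFactor_line_le hz (n := n) (ω₁ := ((a : ℕ) : ℤ)) (ω₂ := ((b : ℕ) : ℤ))
      (Z := fun p => gnCutoff ((π + z) ^ 2 / π ^ 2) ((π + z) ^ 2) (p 0 ^ 2) * gnCutoff ((π + z) ^ 2 / π ^ 2) ((π + z) ^ 2) (p 1 ^ 2) *
        ((radialCutoffC (1 / 2) (momToComplex p) * sectorWeightCirc n ((a : ℕ) : ℤ) (polarAngle p)) *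
          (radialCutoffC (1 / 2) (momToComplex p) * sectorWeightCirc n ((b : ℕ) : ℤ) (polarAngle p)))) (fun _ => rfl)
      hB0 hB p₀ w hsq hfermi
  rw [hline]
  refine ⟨?_, ?_, ?_⟩
  · rw [deriv_fun_sum fun a _ => ?_]
    · calc |∑ a ∈ S₁, deriv (fun σ => ∑ b ∈ S₂, g a b σ) s| ≤ ∑ a ∈ S₁, |deriv (fun σ => ∑ b ∈ S₂, g a b σ) s| :=
            abs_sum_le_sum_abs _ _
        _ ≤ ∑ a ∈ S₁, ∑ b ∈ S₂, 12 * B * D := by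
            refine sum_le_sum fun a _ => ?_
            rw [deriv_fun_sum fun b _ => ((hsm a b).differentiable (by norm_num)) s]
            exact (abs_sum_le_sum_abs _ _).trans (sum_le_sum fun b _ => (hbd a b).1)
        _ = (S₁.card * S₂.card : ℝ) * (12 * B * D) := by
            rw [sum_const, sum_const, nsmul_eq_mul, nsmul_eq_mul]; ring
    · exact DifferentiableAt.fun_sum fun b _ => ((hsm a b).differentiable (by norm_num)) s
  · rw [iteratedDeriv_fun_sum fun a _ => ?_]
    · calc |∑ a ∈ S₁, iteratedDeriv 2 (fun σ => ∑ b ∈ S₂, g a b σ) s| ≤ ∑ a ∈ S₁, |iteratedDeriv 2 (fun σ => ∑ b ∈ S₂, g a b σ) s| :=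
            abs_sum_le_sum_abs _ _
        _ ≤ ∑ a ∈ S₁, ∑ b ∈ S₂, (12 * B + 72 * B ^ 2) * D ^ 2 := by
            refine sum_le_sum fun a _ => ?_
            rw [iteratedDeriv_fun_sum fun b _ => (hsm a b).contDiffAt.of_le (by norm_num)]
            exact (abs_sum_le_sum_abs _ _).trans (sum_le_sum fun b _ => (hbd a b).2.1)
        _ = (S₁.card * S₂.card : ℝ) * ((12 * B + 72 * B ^ 2) * D ^ 2) := by
            rw [sum_const, sum_const, nsmul_eq_mul, nsmul_eq_mul]; ring
    · exact ((ContDiff.sum fun b _ => hsm a b).contDiffAt).of_le (by norm_num)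
  · rw [iteratedDeriv_fun_sum fun a _ => ?_]
    · calc |∑ a ∈ S₁, iteratedDeriv 3 (fun σ => ∑ b ∈ S₂, g a b σ) s| ≤ ∑ a ∈ S₁, |iteratedDeriv 3 (fun σ => ∑ b ∈ S₂, g a b σ) s| :=
            abs_sum_le_sum_abs _ _
        _ ≤ ∑ a ∈ S₁, ∑ b ∈ S₂, (12 * B + 216 * B ^ 2) * D ^ 3 := by
            refine sum_le_sum fun a _ => ?_
            rw [iteratedDeriv_fun_sum fun b _ => (hsm a b).contDiffAt]
            exact (abs_sum_le_sum_abs _ _).trans (sum_le_sum fun b _ => (hbd a b).2.2)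
        _ = (S₁.card * S₂.card : ℝ) * ((12 * B + 216 * B ^ 2) * D ^ 3) := by
            rw [sum_const, sum_const, nsmul_eq_mul, nsmul_eq_mul]; ring
    · exact (ContDiff.sum fun b _ => hsm a b).contDiffAt

end Fat

end Summit.HubbardSuperconductivity.HubbardSuperconductivity.Theorems.TorusFourierL2

end
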